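import Literature.Topology.FourManifolds.SurfaceGroupRestrictionDegree
import Literature.GroupTheory.CombinatorialGroupTheory.SurfaceGroupFiniteIndexSubgroupHolds
import HarnessLib

/-!
# Finite-index subgroups of surface groups, VI: the restriction degree `± [S_g : K]`, unconditionally

Topic `Literature/Topology/FourManifolds`; theorems only.  `SurfaceGroupRestrictionDegree.lean` proved
the restriction formula for the Heisenberg obstruction (`ω_h(Φ|_K ∘ e⁻¹) = ± [S_g : K] · ω_g(Φ)` for
every finite-index `K ≤ S_g`, every `e : K ≃* S_h`, every pair of characters `Φ`) modulo the tree's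
named fact `SurfaceGroupFiniteIndexSubgroup` (finite-index subgroups of surface groups are surface
groups of the Riemann–Hurwitz genus; Zieschang–Vogt–Coldewey LNM 835, Thm 4.14.22).  That fact is now a
THEOREM (`surfaceGroupFiniteIndexSubgroup_holds`, abc-iut-L5-d3 / L5-t16,
`SurfaceGroupFiniteIndexSubgroupHolds.lean`), so the formula holds unconditionally
(`heisenbergObstruction_restrict`) — the cell's former fact-candidate "F_res" (K. S. Brown,
*Cohomology of Groups*, III (9.5)(ii) for surface groups) with no hypothesis left.
-/

namespace Literature.Topology.FourManifolds

namespace SurfaceGroup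

open Literature.GroupTheory.CombinatorialGroupTheory Multiplicative

/-- **Restriction of the Heisenberg obstruction to a finite-index subgroup has degree `± [S_g : K]`,
unconditionally**: for all `g h p`, every `K ≤ S_g` of finite index, every `e : K ≃* S_h` and every
`Φ : S_g → ℤ/p × ℤ/p`. [cite: Brown1982CohomologyGroups, III (9.5)(ii)] -/
theorem heisenbergObstruction_restrict (g h p : ℕ) (K : Subgroup (SurfaceGroup g)) (hK : K.FiniteIndex)
    (e : K ≃* SurfaceGroup h)
    (Φ : SurfaceGroup g →* Multiplicative (ZMod p) × Multiplicative (ZMod p)) :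
    (∑ i : Fin h,
        ((toAdd ((Φ.comp (K.subtype.comp e.symm.toMonoidHom)) (SurfaceGroup.a i)).1) *
          (toAdd ((Φ.comp (K.subtype.comp e.symm.toMonoidHom)) (SurfaceGroup.b i)).2) -
         (toAdd ((Φ.comp (K.subtype.comp e.symm.toMonoidHom)) (SurfaceGroup.a i)).2) *
          (toAdd ((Φ.comp (K.subtype.comp e.symm.toMonoidHom)) (SurfaceGroup.b i)).1))) =
        (K.index : ZMod p) * (∑ i : Fin g,
          ((toAdd (Φ (SurfaceGroup.a i)).1) * (toAdd (Φ (SurfaceGroup.b i)).2) -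
           (toAdd (Φ (SurfaceGroup.a i)).2) * (toAdd (Φ (SurfaceGroup.b i)).1))) ∨
      (∑ i : Fin h,
        ((toAdd ((Φ.comp (K.subtype.comp e.symm.toMonoidHom)) (SurfaceGroup.a i)).1) *
          (toAdd ((Φ.comp (K.subtype.comp e.symm.toMonoidHom)) (SurfaceGroup.b i)).2) -
         (toAdd ((Φ.comp (K.subtype.comp e.symm.toMonoidHom)) (SurfaceGroup.a i)).2) *
          (toAdd ((Φ.comp (K.subtype.comp e.symm.toMonoidHom)) (SurfaceGroup.b i)).1))) =
        -((K.index : ZMod p) * (∑ i : Fin g,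
          ((toAdd (Φ (SurfaceGroup.a i)).1) * (toAdd (Φ (SurfaceGroup.b i)).2) -
           (toAdd (Φ (SurfaceGroup.a i)).2) * (toAdd (Φ (SurfaceGroup.b i)).1)))) :=
  heisenbergObstruction_restrict_of_finiteIndexSubgroup surfaceGroupFiniteIndexSubgroup_holds
    g h p K hK e Φ

end SurfaceGroup

end Literature.Topology.FourManifolds
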